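import Summits.Ventures.QEC.Census.TwoBGA.TB_l3m12_A0_0_0_1_0_3_1_10_B0_0_0_1_2_4_2_9.Data
import HarnessLib

/-!
# Census row `2bga-l3m12-A0-0.0-1.0-3.1-10-B0-0.0-1.2-4.2-9` — Brouwer–Zimmermann block verdicts 12…15 of the `Z` side (298068 codeword visits; fast twin `bzZBlockF`, `decide +kernel`, tier KERNEL). Part 2/2.
-/

set_option Elab.async false

namespace Summit.Ventures.QEC.Census.TB_l3m12_A0_0_0_1_0_3_1_10_B0_0_0_1_2_4_2_9

/-- Block 12 of the `Z` side replays (74517 codeword visits; fast twin `bzZBlockF`, `decide +kernel`). -/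
theorem blkZ_12 : TB_l3m12_A0_0_0_1_0_3_1_10_B0_0_0_1_2_4_2_9.cert.bzZBlockF TB_l3m12_A0_0_0_1_0_3_1_10_B0_0_0_1_2_4_2_9.bz 12 = true := by
  decide +kernel

/-- Block 13 of the `Z` side replays (74517 codeword visits; fast twin `bzZBlockF`, `decide +kernel`). -/
theorem blkZ_13 : TB_l3m12_A0_0_0_1_0_3_1_10_B0_0_0_1_2_4_2_9.cert.bzZBlockF TB_l3m12_A0_0_0_1_0_3_1_10_B0_0_0_1_2_4_2_9.bz 13 = true := by
  decide +kernel

/-- Block 14 of the `Z` side replays (74517 codeword visits; fast twin `bzZBlockF`, `decide +kernel`). -/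
theorem blkZ_14 : TB_l3m12_A0_0_0_1_0_3_1_10_B0_0_0_1_2_4_2_9.cert.bzZBlockF TB_l3m12_A0_0_0_1_0_3_1_10_B0_0_0_1_2_4_2_9.bz 14 = true := by
  decide +kernel

/-- Block 15 of the `Z` side replays (74517 codeword visits; fast twin `bzZBlockF`, `decide +kernel`). -/
theorem blkZ_15 : TB_l3m12_A0_0_0_1_0_3_1_10_B0_0_0_1_2_4_2_9.cert.bzZBlockF TB_l3m12_A0_0_0_1_0_3_1_10_B0_0_0_1_2_4_2_9.bz 15 = true := by
  decide +kernel

end Summit.Ventures.QEC.Census.TB_l3m12_A0_0_0_1_0_3_1_10_B0_0_0_1_2_4_2_9
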